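import Summits.QuantumFields.BalabanUV.Beta.GAN24.MinimiserOneStepDecayCubic
import Summits.QuantumFields.BalabanUV.Beta.GAN24.SavgInverseUniform
import Literature.MathematicalPhysics.QuantumFieldTheory.Balaban1983to89.T4FlagMemoryPolyWeight

/-!
# G-an2-4 ∕ (CONV-C), road P2 — THE SCALAR UNIT-LATTICE FAMILY `k ↦ S_{L^k} = a′Q′G′_{L^k}Q′*` ON A CUBIC UNIT TORUS SATISFIES THE
# ROW's TWO-CLAUSE SHAPE, UNCONDITIONALLY: `|S_{L^k}(y,y′)| ≤ C₄e^{−δ₄|y−y′|}` (k-uniform) AND `|S_{L^{k+1}} − S_{L^k}|(y,y′) ≤ C₄θ^k e^{−δ₄|y−y′|}`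
# with `θ = L^{−1/2}` — the tower reading `N = L^k`, `R = L` of `MinimiserOneStepDecayCubic.norm_Savg_succ_sub_apply_le_cubic`, typed

G-an2-4 formalisation swarm `b2b-balaban-gan24-formalise-*`, leaf prover 06 (gen 36), crux team (2) under the coordinator ruling «YM REDIRECT»
(e34b3e0c; FREEZE (0) honoured — a `GAN24/` corollary importing EXISTING modules only).  The binder row's target SHAPE for a unit-lattice
constituent kernel `𝒦^{(k)}` is the (CONV-C) pair (cell `BETA/AN2.md` §6; `GAN24/DirichletExhaustion.ConvC` over B4's index set):
k-UNIFORM exponential decay `|𝒦^{(k)}|(y,y′) ≤ C₄e^{−δ₄|y−y′|}` AND the geometric one-step rate `|𝒦^{(k+1)} − 𝒦^{(k)}|(y,y′) ≤ C₄θ^k e^{−δ₄|y−y′|}`,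
ONE pair `(C₄, δ₄)`.  The road-P2 owner `b2b-balaban-gan24-p2` (gen 29) READ his one-step laws along the tower `N = L^k`, `R = L`
(«`≤ C′·k·L^{−k}·|v|_∞` at every fine site — summable in k», journal 2026-08-21T10:05Z) without typing the reading.  THIS FILE types it for
the scalar unit-lattice operator `S_n = a′Q′G′_nQ′*` of `HardMinimiserOneStepSup` (King's alias sum ∕ Bałaban's `aQGQ*` on 0-forms at
`U = 1` — the scalar prototype of the covariance-type constituent), on every CUBIC unit torus `fun _ : Fin (d+1) ⇒ N₀`:
 * §1 `tower_rate_le` — the real-variable step `((L−1)∕L^{k+1})·(2 + (k+1)log L + k log L) ≤ 2(1 + log L)(k+1)∕L^k` (`L ≥ 1`);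
 * §2 `Savg_level_congr` (re-indexing `Savg` along `L^{k+1} = L·L^k`) and **`norm_Savg_tower_step_le_cubic`** — `∃ C δ > 0` (functions of
   `d, a′`): `|(S_{L^{k+1}} − S_{L^k})(y,y′)| ≤ C·(1 + log L)·(k+1)·L^{−k}·e^{−δ|y−y′|_{T,∞}}` for EVERY `L, N₀ ≥ 1`, every `k`, all `y, y′` — from
   this lineage's `MinimiserOneStepDecayCubic.norm_Savg_succ_sub_apply_le_cubic` at `N = L^k`, `R = L`;
 * §3 **`convC_shape_Savg_tower_cubic`** — THE TWO CLAUSES: `∃ δ₄ > 0` (function of `d, a′`), `∀ L ≥ 2, ∃ C₄ > 0` (function of `d, a′, L`),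
   `∀ N₀ ≥ 1, ∀ k y y′`: `|S_{L^k}(y,y′)| ≤ C₄e^{−δ₄|y−y′|_{T,∞}}` (clause 1 = leaf-03 gen 49's `SavgEntryDecay.norm_Savg_apply_le`, every n, every
   torus, in `torusSupNorm` currency via `SavgInverseUniform.ldist_eq_torusSupNorm`) ∧ `|(S_{L^{k+1}} − S_{L^k})(y,y′)| ≤ C₄·(1∕√L)^k·e^{−δ₄|y−y′|_{T,∞}}`
   (clause 2 = §2 with `(k+1)·L^{−k} = ((k+1)y^k)·y^k ≤ y^k∕(1−y)`, `y = 1∕√L`, by the tree's `T4FlagMemoryPolyWeight.succ_mul_pow_le`);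
   `δ₄ = min(δ, κ_S)`, `C₄ = max(θ_S, C(1 + log L)∕(1 − 1∕√L))`.
HONEST SCOPE.  [folklore] corollary of tree theorems BY NAME (one `obtain` per input + real arithmetic); scalar (0-form) `U = 1` PROTOTYPE on CUBIC
unit tori in dimension `d + 1`, the unit torus FIXED along the tower (side `N₀`), constants ∕ rates EXISTENTIAL in size; `θ = L^{−1/2}` is a
typing convenience absorbing the factor `(k+1)` (any `θ > L⁻¹` would do; the one-step factor itself is `(1 + log L)(k+1)L^{−k}`).  The carrier is the
finite torus `Tor (fun _ ⇒ N₀)` with complex entries and `‖·‖`, NOT B4's `ℤ^d × Fin N` with `|·|` — so this is the SHAPE of `DirichletExhaustion.ConvC`,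
not an instance of that predicate; NOT (CONV-C) as typed (a statement about Bałaban's constituents `(G_k, H_k, C^{(k)})` with their inputs discharged,
at general `U` in the small-field region), NEVER «G-an2-4 closed», NOT NE2 ∕ NE3, NOT D1, NOT BetaPertH, NOT continuum, NOT Clay; 0 def, 0
`def … : Prop`, 0 cite, 0 sorry — not in print, our bookkeeping.  HONEST DEPENDENCY: continuum YM on T⁴ ⇐ BetaPertH ∧ nine spine estimates (0/9
proved); BetaPertH ⇐ (D1) ∧ (D4) ∧ CAP+tail; G-an2-4 gates asym, D1 and NE2/3/4.
-/

noncomputable section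

open scoped BigOperators ComplexConjugate Matrix

namespace Summit.QuantumFields.BalabanUV.Beta.GAN24.ScalarUnitLatticeTower

open Literature.MathematicalPhysics.QuantumFieldTheory.Balaban1983to89
open B5Prop11Plancherel (Tor fine)
open B6LowerBound2153Torus (rep)
open B4TorusKernel.MultiPeriod (torusSupNorm)
open Summit.QuantumFields.BalabanUV.Beta.GAN24.HardMinimiserOneStepSup (Savg)
open Summit.QuantumFields.BalabanUV.Beta.GAN24.SavgEntryDecay (thetaS kappaS thetaS_pos kappaS_pos norm_Savg_apply_le)
open Summit.QuantumFields.BalabanUV.Beta.GAN24.SavgInverseUniform (ldist_eq_torusSupNorm)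
open Summit.QuantumFields.BalabanUV.Beta.GAN24.MinimiserOneStepDecayCubic (norm_Savg_succ_sub_apply_le_cubic)
open T4FlagMemoryPolyWeight (succ_mul_pow_le)

variable (d : ℕ)

/-! ## §1 A real-variable lemma: the one-step rate along the tower `N = L^k`, `R = L` -/

/-- the one-step rate factor along the tower: for `L ≥ 1`, `k ≥ 0`,
`((L−1)∕L^{k+1})·(2 + (k+1)·log L + k·log L) ≤ 2·(1 + log L)·(k+1)∕L^k`. [folklore] -/
theorem tower_rate_le {L : ℝ} (hL : 1 ≤ L) (k : ℕ) :
    (L - 1) / L ^ (k + 1) * (2 + ((k : ℝ) + 1) * Real.log L + (k : ℝ) * Real.log L)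
      ≤ 2 * (1 + Real.log L) * ((k : ℝ) + 1) / L ^ k := by
  have hL0 : 0 < L := by linarith
  have hlog : 0 ≤ Real.log L := Real.log_nonneg hL
  have hk : (0 : ℝ) ≤ k := Nat.cast_nonneg k
  have hLk : 0 < L ^ k := pow_pos hL0 k
  have h1 : (L - 1) / L ^ (k + 1) ≤ 1 / L ^ k := by
    rw [div_le_div_iff₀ (pow_pos hL0 _) hLk, pow_succ]
    nlinarith
  have h2 : 2 + ((k : ℝ) + 1) * Real.log L + (k : ℝ) * Real.log L ≤ 2 * (1 + Real.log L) * ((k : ℝ) + 1) := by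
    nlinarith
  calc (L - 1) / L ^ (k + 1) * (2 + ((k : ℝ) + 1) * Real.log L + (k : ℝ) * Real.log L)
      ≤ (1 / L ^ k) * (2 * (1 + Real.log L) * ((k : ℝ) + 1)) :=
        mul_le_mul h1 h2 (by positivity) (by positivity)
    _ = 2 * (1 + Real.log L) * ((k : ℝ) + 1) / L ^ k := by ring

/-! ## §2 The one-step kernel along the tower `k ↦ S_{L^k}` on cubic unit tori -/

variable {d} in
/-- re-indexing the level of `Savg` along an equality of naturals (the `NeZero` instance is a proposition). [folklore] -/
theorem Savg_level_congr {M : Fin (d + 1) → ℕ} [∀ μ, NeZero (M μ)] {n m : ℕ} [NeZero n] [NeZero m] (h : n = m) (a' : ℝ) :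
    Savg n M a' = Savg m M a' := by
  subst h; rfl

/-- **THE TOWER STEP, UNCONDITIONAL**: `∃ C δ > 0` (functions of `d, a′`) such that for every `L ≥ 1`, every `N₀ ≥ 1`, every level `k`
and all unit sites `y, y′` of the cubic torus, `|(S_{L^{k+1}} − S_{L^k})(y, y′)| ≤ C·(1 + log L)·(k+1)·L^{−k}·e^{−δ·|y − y′|_{T,∞}}`. [folklore] -/
theorem norm_Savg_tower_step_le_cubic {a' : ℝ} (ha' : 0 < a') :
    ∃ C δ : ℝ, 0 < C ∧ 0 < δ ∧ ∀ (L N₀ : ℕ) [NeZero L] [NeZero N₀] (k : ℕ) (y y' : Tor (fun _ : Fin (d + 1) => N₀)),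
      ‖(Savg (L ^ (k + 1)) (fun _ : Fin (d + 1) => N₀) a' - Savg (L ^ k) (fun _ : Fin (d + 1) => N₀) a') y y'‖
        ≤ C * (1 + Real.log (L : ℝ)) * ((k : ℝ) + 1) / (L : ℝ) ^ k
            * Real.exp (-(δ * torusSupNorm (fun _ : Fin (d + 1) => N₀)
                (rep (fun _ : Fin (d + 1) => N₀) y - rep (fun _ : Fin (d + 1) => N₀) y'))) := by
  obtain ⟨C, δ, hC, hδ, h⟩ := norm_Savg_succ_sub_apply_le_cubic d ha'
  refine ⟨2 * C, δ, by positivity, hδ, fun L N₀ _ _ k y y' => ?_⟩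
  have hL : (1 : ℝ) ≤ L := by exact_mod_cast Nat.one_le_iff_ne_zero.mpr (NeZero.ne L)
  set E := Real.exp (-(δ * torusSupNorm (fun _ : Fin (d + 1) => N₀)
    (rep (fun _ : Fin (d + 1) => N₀) y - rep (fun _ : Fin (d + 1) => N₀) y')))
  have hE : 0 ≤ E := (Real.exp_pos _).le
  have key := h (L ^ k) L N₀ y y'
  rw [Savg_level_congr (pow_succ' L k) a']
  push_cast at key
  rw [show (L : ℝ) * (L : ℝ) ^ k = (L : ℝ) ^ (k + 1) from (pow_succ' _ _).symm, Real.log_pow, Real.log_pow] at key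
  have hr := tower_rate_le hL k
  calc ‖(Savg (L * L ^ k) (fun _ : Fin (d + 1) => N₀) a' - Savg (L ^ k) (fun _ : Fin (d + 1) => N₀) a') y y'‖
      ≤ C * (((L : ℝ) - 1) / (L : ℝ) ^ (k + 1)) * (2 + ((k + 1 : ℕ) : ℝ) * Real.log L + (k : ℝ) * Real.log L) * E := key
    _ = C * (((L : ℝ) - 1) / (L : ℝ) ^ (k + 1) * (2 + ((k : ℝ) + 1) * Real.log L + (k : ℝ) * Real.log L)) * E := by
        push_cast; ring
    _ ≤ C * (2 * (1 + Real.log L) * ((k : ℝ) + 1) / L ^ k) * E :=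
        mul_le_mul_of_nonneg_right (mul_le_mul_of_nonneg_left hr hC.le) hE
    _ = 2 * C * (1 + Real.log (L : ℝ)) * ((k : ℝ) + 1) / (L : ℝ) ^ k * E := by ring

/-! ## §3 The two clauses of the (CONV-C) shape for the scalar unit-lattice family `k ↦ S_{L^k}`, on every cubic unit torus -/

/-- **THE (CONV-C) TWO-CLAUSE SHAPE FOR THE SCALAR PROTOTYPE `S_{L^k} = a′Q′G′_{L^k}Q′*` ON CUBIC UNIT TORI, UNCONDITIONAL.**  There is a rate
`δ₄ > 0` (a function of `d, a′`) such that for every `L ≥ 2` there is `C₄ > 0` (a function of `d, a′, L`) with, for every `N₀ ≥ 1`, every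
level `k` and all unit sites `y, y′` of `Π_μ ℤ/N₀` (dimension `d+1`):
`|S_{L^k}(y, y′)| ≤ C₄·e^{−δ₄|y − y′|_{T,∞}}` (k-UNIFORM DECAY) and `|(S_{L^{k+1}} − S_{L^k})(y, y′)| ≤ C₄·(1∕√L)^k·e^{−δ₄|y − y′|_{T,∞}}`
(GEOMETRIC ONE-STEP RATE, `θ = L^{−1/2}`), ONE pair `(C₄, δ₄)`. [folklore] -/
theorem convC_shape_Savg_tower_cubic {a' : ℝ} (ha' : 0 < a') :
    ∃ δ₄ : ℝ, 0 < δ₄ ∧ ∀ (L : ℕ) [NeZero L], 2 ≤ L → ∃ C₄ : ℝ, 0 < C₄ ∧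
      ∀ (N₀ : ℕ) [NeZero N₀] (k : ℕ) (y y' : Tor (fun _ : Fin (d + 1) => N₀)),
        ‖Savg (L ^ k) (fun _ : Fin (d + 1) => N₀) a' y y'‖
            ≤ C₄ * Real.exp (-(δ₄ * torusSupNorm (fun _ : Fin (d + 1) => N₀)
                (rep (fun _ : Fin (d + 1) => N₀) y - rep (fun _ : Fin (d + 1) => N₀) y'))) ∧
        ‖(Savg (L ^ (k + 1)) (fun _ : Fin (d + 1) => N₀) a' - Savg (L ^ k) (fun _ : Fin (d + 1) => N₀) a') y y'‖
            ≤ C₄ * ((Real.sqrt L)⁻¹) ^ k * Real.exp (-(δ₄ * torusSupNorm (fun _ : Fin (d + 1) => N₀)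
                (rep (fun _ : Fin (d + 1) => N₀) y - rep (fun _ : Fin (d + 1) => N₀) y'))) := by
  obtain ⟨C, δ, hC, hδ, h⟩ := norm_Savg_tower_step_le_cubic d ha'
  have hθS := thetaS_pos (d + 1) ha'
  have hκS := kappaS_pos (d + 1) a'
  refine ⟨min δ (kappaS (d + 1) a'), lt_min hδ hκS, fun L _ hL2 => ?_⟩
  have hL1 : (1 : ℝ) < L := by exact_mod_cast hL2
  have hL0 : (0 : ℝ) < L := by linarith
  have hlog : 0 ≤ Real.log (L : ℝ) := Real.log_nonneg hL1.le
  set y : ℝ := (Real.sqrt L)⁻¹ with hy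
  have hsq : 1 < Real.sqrt L := by
    rw [show (1 : ℝ) = Real.sqrt 1 from Real.sqrt_one.symm]
    exact Real.sqrt_lt_sqrt zero_le_one hL1
  have hy0 : 0 < y := inv_pos.mpr (by linarith)
  have hy1 : y < 1 := inv_lt_one_of_one_lt₀ hsq
  have hyy : ∀ k : ℕ, ((L : ℝ) ^ k)⁻¹ = y ^ k * y ^ k := fun k => by
    rw [hy, ← mul_pow, ← mul_inv, Real.mul_self_sqrt hL0.le, inv_pow]
  set C₄ := max (thetaS (d + 1) a') (C * (1 + Real.log L) / (1 - y))
  have hC₄pos : 0 < C₄ := lt_max_of_lt_left hθS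
  refine ⟨C₄, hC₄pos, ?_⟩
  intro N₀ _ k y₁ y₂
  set t := torusSupNorm (fun _ : Fin (d + 1) => N₀)
      (rep (fun _ : Fin (d + 1) => N₀) y₁ - rep (fun _ : Fin (d + 1) => N₀) y₂)
  have ht : 0 ≤ t :=
    B4TorusKernel.MultiPeriod.torusSupNorm_nonneg (fun _ => Nat.one_le_iff_ne_zero.mpr (NeZero.ne N₀)) _
  refine ⟨?_, ?_⟩
  · -- clause 1: k-uniform decay, leaf-03 gen 49's `SavgEntryDecay.norm_Savg_apply_le`, rate lowered to `δ₄ ≤ κ_S`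
    have h1 := norm_Savg_apply_le (L ^ k) (fun _ : Fin (d + 1) => N₀) ha' y₁ y₂
    rw [ldist_eq_torusSupNorm] at h1
    have hEκ : Real.exp (-(kappaS (d + 1) a' * t)) ≤ Real.exp (-(min δ (kappaS (d + 1) a') * t)) :=
      Real.exp_le_exp.mpr (by nlinarith [min_le_right δ (kappaS (d + 1) a')])
    exact h1.trans (mul_le_mul (le_max_left _ _) hEκ (Real.exp_pos _).le hC₄pos.le)
  · -- clause 2: the tower step, with `(k+1)·L^{−k} = ((k+1)·y^k)·y^k ≤ y^k∕(1 − y)`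
    have h2 := h L N₀ k y₁ y₂
    have hEδ : Real.exp (-(δ * t)) ≤ Real.exp (-(min δ (kappaS (d + 1) a') * t)) :=
      Real.exp_le_exp.mpr (by nlinarith [min_le_left δ (kappaS (d + 1) a')])
    have hgeo := succ_mul_pow_le hy0.le hy1 k
    have hyk : 0 ≤ y ^ k := pow_nonneg hy0.le k
    have hcoef : C * (1 + Real.log (L : ℝ)) * ((k : ℝ) + 1) / (L : ℝ) ^ k ≤ C₄ * y ^ k :=
      calc C * (1 + Real.log (L : ℝ)) * ((k : ℝ) + 1) / (L : ℝ) ^ k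
          = C * (1 + Real.log (L : ℝ)) * (((k : ℝ) + 1) * y ^ k) * y ^ k := by
            rw [div_eq_mul_inv, hyy k]; ring
        _ ≤ C * (1 + Real.log (L : ℝ)) * (1 / (1 - y)) * y ^ k :=
            mul_le_mul_of_nonneg_right (mul_le_mul_of_nonneg_left hgeo (by positivity)) hyk
        _ = C * (1 + Real.log L) / (1 - y) * y ^ k := by ring
        _ ≤ C₄ * y ^ k := mul_le_mul_of_nonneg_right (le_max_right _ _) hyk
    exact h2.trans (mul_le_mul hcoef hEδ (Real.exp_pos _).le (mul_nonneg hC₄pos.le hyk))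

/-! ## §4 The `η → 0` limit along the tower: the unit-lattice kernel converges entrywise with geometric rate and uniform localisation
(APPEND, gen 36; the END-grade currency `|s_k − s_∞| ≤ c₀θ^k` of `Beta.RateCertificate` ∕ `Beta.Assembly.LimitForm.conv` reached on the scalar
prototype — an observation of the XREAD C-asym1g81-2 (R2), re-proved here) -/

section Limit

open Filter

/-- **THE TOWER LIMIT OF THE SCALAR UNIT-LATTICE KERNEL, UNCONDITIONAL**: there is `δ₄ > 0` (a function of `d, a′`) such that for every `L ≥ 2` there
is `C₅ > 0` (a function of `d, a′, L`) with: on every cubic unit torus `T = Π_μ ℤ∕N₀` there is a kernel `S_∞ : Tor T → Tor T → ℂ` such that for all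
unit sites `y, y′` and every level `k`,
`S_{L^k}(y,y′) → S_∞(y,y′)` (`k → ∞`), `|S_{L^k}(y,y′) − S_∞(y,y′)| ≤ C₅·(1∕√L)^k·e^{−δ₄|y−y′|_{T,∞}}` and `|S_∞(y,y′)| ≤ C₅·e^{−δ₄|y−y′|_{T,∞}}`
— clause 2 of `convC_shape_Savg_tower_cubic` summed geometrically (`cauchySeq_of_le_geometric`, completeness of `ℂ`,
`dist_le_of_le_geometric_of_tendsto`) and clause 1 passed to the limit; `C₅ = 2C₄∕(1 − 1∕√L)`. [folklore] -/
theorem tendsto_Savg_tower_cubic {a' : ℝ} (ha' : 0 < a') :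
    ∃ δ₄ : ℝ, 0 < δ₄ ∧ ∀ (L : ℕ) [NeZero L], 2 ≤ L → ∃ C₅ : ℝ, 0 < C₅ ∧
      ∀ (N₀ : ℕ) [NeZero N₀], ∃ Sinf : Tor (fun _ : Fin (d + 1) => N₀) → Tor (fun _ : Fin (d + 1) => N₀) → ℂ,
        ∀ (y y' : Tor (fun _ : Fin (d + 1) => N₀)),
          Tendsto (fun k : ℕ => Savg (L ^ k) (fun _ : Fin (d + 1) => N₀) a' y y') atTop (nhds (Sinf y y')) ∧
          (∀ k : ℕ, ‖Savg (L ^ k) (fun _ : Fin (d + 1) => N₀) a' y y' - Sinf y y'‖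
              ≤ C₅ * ((Real.sqrt L)⁻¹) ^ k * Real.exp (-(δ₄ * torusSupNorm (fun _ : Fin (d + 1) => N₀)
                  (rep (fun _ : Fin (d + 1) => N₀) y - rep (fun _ : Fin (d + 1) => N₀) y')))) ∧
          ‖Sinf y y'‖ ≤ C₅ * Real.exp (-(δ₄ * torusSupNorm (fun _ : Fin (d + 1) => N₀)
              (rep (fun _ : Fin (d + 1) => N₀) y - rep (fun _ : Fin (d + 1) => N₀) y'))) := by
  obtain ⟨δ₄, hδ₄, hall⟩ := convC_shape_Savg_tower_cubic d ha'
  refine ⟨δ₄, hδ₄, fun L _ hL2 => ?_⟩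
  obtain ⟨C₄, hC₄, h⟩ := hall L hL2
  have hL1 : (1 : ℝ) < L := by exact_mod_cast hL2
  set θ : ℝ := (Real.sqrt L)⁻¹ with hθ
  have hsq : 1 < Real.sqrt L := by
    rw [show (1 : ℝ) = Real.sqrt 1 from Real.sqrt_one.symm]
    exact Real.sqrt_lt_sqrt zero_le_one hL1
  have hθ0 : 0 ≤ θ := inv_nonneg.mpr (Real.sqrt_nonneg _)
  have hθ1 : θ < 1 := inv_lt_one_of_one_lt₀ hsq
  have h1θ : 0 < 1 - θ := by linarith
  refine ⟨2 * C₄ / (1 - θ), by positivity, fun N₀ _ => ?_⟩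
  -- the entrywise statement, then `choose`
  have key : ∀ y y' : Tor (fun _ : Fin (d + 1) => N₀), ∃ s : ℂ,
      Tendsto (fun k : ℕ => Savg (L ^ k) (fun _ : Fin (d + 1) => N₀) a' y y') atTop (nhds s) ∧
      (∀ k : ℕ, ‖Savg (L ^ k) (fun _ : Fin (d + 1) => N₀) a' y y' - s‖
          ≤ 2 * C₄ / (1 - θ) * θ ^ k * Real.exp (-(δ₄ * torusSupNorm (fun _ : Fin (d + 1) => N₀)
              (rep (fun _ : Fin (d + 1) => N₀) y - rep (fun _ : Fin (d + 1) => N₀) y')))) ∧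
      ‖s‖ ≤ 2 * C₄ / (1 - θ) * Real.exp (-(δ₄ * torusSupNorm (fun _ : Fin (d + 1) => N₀)
          (rep (fun _ : Fin (d + 1) => N₀) y - rep (fun _ : Fin (d + 1) => N₀) y'))) := by
    intro y y'
    set E := Real.exp (-(δ₄ * torusSupNorm (fun _ : Fin (d + 1) => N₀)
      (rep (fun _ : Fin (d + 1) => N₀) y - rep (fun _ : Fin (d + 1) => N₀) y'))) with hE
    have hE0 : 0 < E := Real.exp_pos _
    set u : ℕ → ℂ := fun k => Savg (L ^ k) (fun _ : Fin (d + 1) => N₀) a' y y' with hu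
    have hstep : ∀ k, dist (u k) (u (k + 1)) ≤ C₄ * E * θ ^ k := by
      intro k
      rw [dist_comm, dist_eq_norm]
      have h2 := (h N₀ k y y').2
      rw [Matrix.sub_apply] at h2
      calc ‖u (k + 1) - u k‖ ≤ C₄ * θ ^ k * E := h2
        _ = C₄ * E * θ ^ k := by ring
    have hcau : CauchySeq u := cauchySeq_of_le_geometric θ (C₄ * E) hθ1 hstep
    obtain ⟨s, hs⟩ := cauchySeq_tendsto_of_complete hcau
    have hdist : ∀ k, dist (u k) s ≤ C₄ * E * θ ^ k / (1 - θ) := fun k =>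
      dist_le_of_le_geometric_of_tendsto θ (C₄ * E) hθ1 hstep hs k
    have hCE : 0 ≤ C₄ * E := by positivity
    refine ⟨s, hs, fun k => ?_, ?_⟩
    · have hk := hdist k
      rw [dist_eq_norm] at hk
      have hθk : 0 ≤ θ ^ k := pow_nonneg hθ0 k
      calc ‖u k - s‖ ≤ C₄ * E * θ ^ k / (1 - θ) := hk
        _ ≤ 2 * (C₄ * E * θ ^ k) / (1 - θ) := by
            rw [div_le_div_iff_of_pos_right h1θ]; nlinarith [mul_nonneg hCE hθk]
        _ = 2 * C₄ / (1 - θ) * θ ^ k * E := by field_simp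
    · have h0 := hdist 0
      rw [dist_eq_norm, pow_zero, mul_one] at h0
      have hc1 : ‖u 0‖ ≤ C₄ * E := (h N₀ 0 y y').1
      have htri : ‖s‖ ≤ ‖u 0‖ + ‖u 0 - s‖ := by
        have := norm_sub_le (u 0) (u 0 - s); rwa [sub_sub_cancel] at this
      have hup : C₄ * E ≤ C₄ * E / (1 - θ) := by
        rw [le_div_iff₀ h1θ]; nlinarith
      calc ‖s‖ ≤ ‖u 0‖ + ‖u 0 - s‖ := htri
        _ ≤ C₄ * E / (1 - θ) + C₄ * E / (1 - θ) := add_le_add (hc1.trans hup) h0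
        _ = 2 * C₄ / (1 - θ) * E := by field_simp; ring
  choose Sinf hS using key
  exact ⟨Sinf, fun y y' => hS y y'⟩

end Limit

end Summit.QuantumFields.BalabanUV.Beta.GAN24.ScalarUnitLatticeTower

end
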